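import Mathlib
import Summits.Ventures.PercRepro2.A3CutPullBase

/-!
# The mark `o` behind a cut vertex `y` of the explored vertex pulls back to `y`
(blind cell PercRepro2, night-1 g33; proofs/NIGHT1-G33.md §8; census mining/night-1/g33/check_mark_pull.py
186/186)

Setting of A3CutPullBase: `y` a cut vertex, `x, a₁, a₂ ∈ VB ∪ {y}`, the mark `o ∈ VA` behind `y`, the
mark `b` arbitrary.  Since `F⁰_o(γ_o) = P(y ↔ o) F⁰_y(γ_y)` on every fibre (`SFg_pull`, `gamma_pull`) and
`U_o = P(y ↔ o) U_y` on the `A`-fibres (`Su_pull_fibresA`), both the means-level form and the first-order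
functional are linear in these:

  **`btw(x; o) = P(y ↔ o) · btw(x; y)`**  (`btw_pull_o`),  **`FMfun(x; o) = P(y ↔ o) · FMfun(x; y)`**
  (`FMfun_pull_o`),

so (MEANS-a₃), (FM) and (HCOV) at `x` with the mark `o` follow from the same statements with `o` moved to
the cut vertex `y` (`A3Between_pull_o`, `FM_pull_o`, `HCov_pull_o`) — the mark-pull-back step of the
exploration-martingale reduction.  Standard axioms.
-/

namespace Summit.Ventures.PercRepro2

open UnionCluster CovForm CutV

namespace CovForm

namespace A3Fibre

namespace MarkPull

section PullO

variable {V : Type*} {E : Type*} [Fintype V] [DecidableEq V] [Fintype E] [DecidableEq E]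
  {R : Type*} [Field R] [LinearOrder R] [IsStrictOrderedRing R] {ends : E → Sym2 V} {y : V}
  {VA VB : Finset V} {EA EB : Set E} [DecidablePred (· ∈ EA)] [DecidablePred (· ∈ EB)] {p : E → R}
  {x a₁ a₂ o b : V}

omit [LinearOrder R] [IsStrictOrderedRing R] in
/-- `∑_W Sb · F⁰_o(P(y ↔ o) γ) / m_W = P(y ↔ o) · ∑_W Sb · F⁰_y(γ) / m_W`. -/
lemma sum_term_pull_o (h : IsCut ends y ↑VA ↑VB EA EB) (hx : x ∈ insert y VB)
    (h1 : a₁ ∈ insert y VB) (h2 : a₂ ∈ insert y VB) (ho : o ∈ VA) (γ : R) :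
    ∑ W : Finset V, Ssig p ends a₁ a₂ x b W *
        RootEdge.SFg p ends o a₁ a₂ x (prob p (connEvent ends y o) * γ) W / mW p ends a₁ a₂ x W =
      prob p (connEvent ends y o) *
        ∑ W : Finset V, Ssig p ends a₁ a₂ x b W * RootEdge.SFg p ends y a₁ a₂ x γ W /
          mW p ends a₁ a₂ x W := by
  rw [Finset.mul_sum]
  refine Finset.sum_congr rfl fun W _ => ?_
  rw [SFg_pull h hx h1 h2 ho γ W]
  ring

omit [LinearOrder R] [IsStrictOrderedRing R] in
/-- `∑_W F⁰_o(P(y ↔ o) γ) = P(y ↔ o) · ∑_W F⁰_y(γ)`. -/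
lemma sum_SFg_pull_o (h : IsCut ends y ↑VA ↑VB EA EB) (hx : x ∈ insert y VB)
    (h1 : a₁ ∈ insert y VB) (h2 : a₂ ∈ insert y VB) (ho : o ∈ VA) (γ : R) :
    ∑ W : Finset V, RootEdge.SFg p ends o a₁ a₂ x (prob p (connEvent ends y o) * γ) W =
      prob p (connEvent ends y o) * ∑ W : Finset V, RootEdge.SFg p ends y a₁ a₂ x γ W := by
  rw [Finset.mul_sum]
  exact Finset.sum_congr rfl fun W _ => SFg_pull h hx h1 h2 ho γ W

omit [LinearOrder R] [IsStrictOrderedRing R] in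
/-- `∑_A Sub · Suo / m_W = P(y ↔ o) · ∑_A Sub · Suy / m_W`. -/
lemma sum_termA_pull_o (h : IsCut ends y ↑VA ↑VB EA EB) (hx : x ∈ insert y VB)
    (h1 : a₁ ∈ insert y VB) (h2 : a₂ ∈ insert y VB) (ho : o ∈ VA) :
    ∑ W ∈ fibresA a₁ a₂, Su p ends a₁ a₂ x b W * Su p ends a₁ a₂ x o W / mW p ends a₁ a₂ x W =
      prob p (connEvent ends y o) *
        ∑ W ∈ fibresA a₁ a₂, Su p ends a₁ a₂ x b W * Su p ends a₁ a₂ x y W /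
          mW p ends a₁ a₂ x W := by
  rw [Finset.mul_sum]
  refine Finset.sum_congr rfl fun W hW => ?_
  rw [Su_pull_fibresA h hx h1 h2 ho hW]
  ring

omit [LinearOrder R] [IsStrictOrderedRing R] in
/-- `∑_A Suo = P(y ↔ o) · ∑_A Suy`. -/
lemma sum_SuA_pull_o (h : IsCut ends y ↑VA ↑VB EA EB) (hx : x ∈ insert y VB)
    (h1 : a₁ ∈ insert y VB) (h2 : a₂ ∈ insert y VB) (ho : o ∈ VA) :
    ∑ W ∈ fibresA a₁ a₂, Su p ends a₁ a₂ x o W =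
      prob p (connEvent ends y o) * ∑ W ∈ fibresA a₁ a₂, Su p ends a₁ a₂ x y W := by
  rw [Finset.mul_sum]
  exact Finset.sum_congr rfl fun W hW => Su_pull_fibresA h hx h1 h2 ho hW

omit [LinearOrder R] [IsStrictOrderedRing R] in
/-- **The mark `o` pulls back to the cut vertex**: `btw(x; o) = P(y ↔ o) · btw(x; y)`. -/
theorem btw_pull_o (h : IsCut ends y ↑VA ↑VB EA EB) (hx : x ∈ insert y VB)
    (h1 : a₁ ∈ insert y VB) (h2 : a₂ ∈ insert y VB) (ho : o ∈ VA) :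
    btw p ends o a₁ a₂ x b = prob p (connEvent ends y o) * btw p ends y a₁ a₂ x b := by
  rw [← RootEdge.btwg_gamma, ← RootEdge.btwg_gamma, gamma_pull h hx h1 h2 ho]
  unfold RootEdge.btwg
  rw [sum_term_pull_o h hx h1 h2 ho, sum_SFg_pull_o h hx h1 h2 ho, sum_termA_pull_o h hx h1 h2 ho,
    sum_SuA_pull_o h hx h1 h2 ho]
  ring

omit [LinearOrder R] [IsStrictOrderedRing R] in
/-- **The mark `o` pulls back to the cut vertex in the first-order functional**:
`FMfun(x; o) = P(y ↔ o) · FMfun(x; y)`. -/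
theorem FMfun_pull_o (h : IsCut ends y ↑VA ↑VB EA EB) (hx : x ∈ insert y VB)
    (h1 : a₁ ∈ insert y VB) (h2 : a₂ ∈ insert y VB) (ho : o ∈ VA) :
    FMfun p ends o a₁ a₂ x b = prob p (connEvent ends y o) * FMfun p ends y a₁ a₂ x b := by
  unfold FMfun
  rw [gamma0_pull h h1 h2 ho, sum_term_pull_o h hx h1 h2 ho, sum_SFg_pull_o h hx h1 h2 ho,
    sum_termA_pull_o h hx h1 h2 ho, sum_SuA_pull_o h hx h1 h2 ho, mU_pull h h1 h2 ho]
  ring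

/-- (MEANS-a₃) at `x` with the mark `o` behind the cut vertex `y` follows from (MEANS-a₃) at `x` with
the mark moved to `y`. -/
theorem A3Between_pull_o (hp : IsProbVec p) (h : IsCut ends y ↑VA ↑VB EA EB) (hx : x ∈ insert y VB)
    (h1 : a₁ ∈ insert y VB) (h2 : a₂ ∈ insert y VB) (ho : o ∈ VA)
    (hy : A3Between p ends y a₁ a₂ x b) : A3Between p ends o a₁ a₂ x b := by
  unfold A3Between
  rw [btw_pull_o h hx h1 h2 ho]
  exact mul_nonneg (prob_nonneg hp _) hy

/-- (FM) at `x` with the mark `o` behind the cut vertex `y` follows from (FM) at `x` with the mark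
moved to `y`. -/
theorem FM_pull_o (hp : IsProbVec p) (h : IsCut ends y ↑VA ↑VB EA EB) (hx : x ∈ insert y VB)
    (h1 : a₁ ∈ insert y VB) (h2 : a₂ ∈ insert y VB) (ho : o ∈ VA) (hy : FM p ends y a₁ a₂ x b) :
    FM p ends o a₁ a₂ x b := by
  unfold FM
  rw [FMfun_pull_o h hx h1 h2 ho]
  exact mul_nonneg (prob_nonneg hp _) hy

/-- (HCOV) at `x` with the mark `o` behind the cut vertex `y` follows from (MEANS-a₃) at `x` with the
mark moved to `y`. -/
theorem HCov_pull_o (hp : IsProbVec p) (h : IsCut ends y ↑VA ↑VB EA EB) (hx : x ∈ insert y VB)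
    (h1 : a₁ ∈ insert y VB) (h2 : a₂ ∈ insert y VB) (ho : o ∈ VA)
    (hy : A3Between p ends y a₁ a₂ x b) : HCov p ends o a₁ a₂ x b :=
  HCov_of_a3Between hp ends o a₁ a₂ x b (A3Between_pull_o hp h hx h1 h2 ho hy)

end PullO

end MarkPull

end A3Fibre

end CovForm

end Summit.Ventures.PercRepro2
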